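import Mathlib
import HarnessLib
import Summits.HubbardSuperconductivity.HubbardSuperconductivity.Theorems.KLProgrammeKLRegimeCountertermJacksonRemainderReadResidueC1IH
import Summits.HubbardSuperconductivity.HubbardSuperconductivity.Theorems.KLProgrammeKLRegimeCountertermJacksonRemainderCertFrameRecord8192
import Summits.HubbardSuperconductivity.HubbardSuperconductivity.Theorems.KLProgrammeKLRegimeCountertermJacksonRemainderCertFrameRecord32768

/-!
# Route `KLProgramme`, crux K3 — gen-8 ENGINE-FLOW child (stmt-HubbardSuperconductivity-20437 `KLRegimeEngineV17F2`), stub (C)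
# `stub_twoLeg_curvature`: the ONE-CALL (C1) door on the WHOLE TABLE BRANCH `n + 1 ≤ 5` of plan (γ″) — frame sizes for `n ≤ 21`, the
# `d = 8192 / 32768` records, and the `_klEng` wrappers with the reading-scale restriction lifted to `n + 1 ≤ 21`

Seat hubbard-kl-k3c3-p1 (g9; row «δμ-flow with klAngularMean constant piece»).  Plan of record (γ″) (pen (R79i), KL STATUS 2026-08-27 l.4211):
the (C1) bracket of the residue split is certified by TABLES at the reading scales `n + 1 ≤ 5` (`d = klFlowDeg n ∈ {128, 512, 2048, 8192, 32768}`;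
records `…CertFrameRecord128Refined/512/2048` (this seat, g7) and `…CertFrameRecord8192/32768` (k3c3-p3 g11)) and by k3c3-p3's ANALYTIC
certificate from `n + 1 = 6` on — through ONE door, `readResidueC1_jets_of_certFrame` (p586216).  The stub-binder wrappers of p586216/p586985
(`…_klEng`) carried `n + 1 ≤ 4` only because `flowFrame_sizes_le_of_klEngU₀4` was proved for `n ≤ 4`; the arithmetic holds much further
(`16²¹·Gfr₄·U/15 ≤ 2⁸⁴⁻¹²⁷/15 < 10⁻¹²` below `klEngU₀4`).  This file:

* §1 `flowFrame_sizes_le_of_klEngU₀4_of_le` / `…U₀9_of_le` / `flowFrame_sizes_le_table_of_klEngU₀9_of_le` — every frame size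
  `‖Dʲ evalM K_n‖ ≤ 10⁻¹²` (`j ≤ 4`) for **`n ≤ 21`** from the history's `FlowPieceJetsAt … m` (`m < n`);
* §2 `klC1FrameAF8192_ge`, `klC1FrameAF32768_ge`, `klC1FrameA_records_ge₆` — the two deep records' size tables are `≡ 10⁻¹²` on `j ≤ 4` too;
* §3 **`readResidueC1_jets_of_certFrame_klEng_of_le`** and **`readResidueC1_jets_of_twoLegReadJetBound_klEng_of_le`** — the one-call doors at the
  stub's binders with `n + 1 ≤ 21` (so the table branch `n + 1 ≤ 5` is served at every registered degree, and any deeper certificate at a table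
  `A ≥ 10⁻¹²` composes verbatim);
* §4 the five fully instantiated table calls `readResidueC1_jets_table128r/512/2048/8192/32768` (`n = 0 … 4`, `hd` by `norm_num [klFlowDeg]`),
  each reading exactly ONE named numerical hypothesis `CutoffDefectCertFrame d klC1FrameAF… klC1TableF…`.

Assembly + arithmetic only; no definitions; every certificate Prop stays a hypothesis; nothing here asserts superconductivity.
-/

noncomputable section

namespace Summit.HubbardSuperconductivity.HubbardSuperconductivity.Theorems.KLRegimeSplit

set_option linter.dupNamespace false -- summit = problem name (single-conjunct summit), D-0017

open Real
open Literature.MathematicalPhysics.QuantumLattice Literature.Probability.LatticeModels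
open Summit.HubbardSuperconductivity.HubbardSuperconductivity.Theorems.PerturbedFermiCurve
open Summit.HubbardSuperconductivity.HubbardSuperconductivity.Theorems.EngineV8

/-! ## §1 Frame sizes of `K_n` for `n ≤ 21` below `klEngU₀4` -/

section FrameSizes

variable {L M : ℕ} [NeZero L] [NeZero M]

/-- **Frame sizes `≤ 10⁻¹²` for `n ≤ 21`**: `R.WF`, `0 < U ≤ klEngU₀4 P R c` and the history's flow-piece jets at every scale `m < n` give
`‖Dʲ evalM K_n‖ ≤ 10⁻¹²` for `j ≤ 4` (the binding row is `j = 4`: `Gfr₄U²16ⁿ/15 ≤ 16²¹·2⁻¹²⁷/15`). -/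
theorem flowFrame_sizes_le_of_klEngU₀4_of_le {P : SplitConsts} {R : RenConsts} (hRW : R.WF) {c β U μ : ℝ} (hU : 0 < U)
    (hUle : U ≤ klEngU₀4 P R c) {n : ℕ} (hn : n ≤ 21) (hist : ∀ m < n, FlowPieceJetsAt L M β U μ R m) :
    ∀ j ≤ 4, ∀ p : EuclideanSpace ℝ (Fin 2),
      ‖iteratedFDeriv ℝ j (fun q : EuclideanSpace ℝ (Fin 2) => (klFlowFrameU L M β U μ n).eval (WithLp.ofLp q)) p‖ ≤ 1 / 10 ^ 12 := by
  intro j hj p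
  have hR : ∀ j, 0 ≤ R.Gfr j := hRW.2.2
  obtain ⟨h0, h1, h2, h3, h4⟩ := flowFrame_sizes_closed (L := L) (M := M) (β := β) (μ := μ) hR hist p
  have hg : ∀ i < 5, R.Gfr i * U ≤ 1 / 2 ^ 127 := fun i hi => gfr_mul_le_of_le_klEngU₀4 hRW hUle hi
  have hU1 : U ≤ 1 := by
    have h := hUle.trans (klEngU₀4_le_inv_gfr_add_one P hRW c (show 0 < 5 by norm_num))
    have hG0 := hR 0
    calc U ≤ 1 / (R.Gfr 0 + 1) := h
      _ ≤ 1 := by rw [div_le_one (by linarith)]; linarith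
  have hUabs : |U| = U := abs_of_pos hU
  have hU2 : U ^ 2 ≤ U := by nlinarith
  have h4n : (4 : ℝ) ^ n ≤ 4 ^ 21 := pow_le_pow_right₀ (by norm_num) hn
  have h16n : (16 : ℝ) ^ n ≤ 16 ^ 21 := pow_le_pow_right₀ (by norm_num) hn
  have hn21 : (n : ℝ) ≤ 21 := by exact_mod_cast hn
  have e : (fun q : EuclideanSpace ℝ (Fin 2) => (klFlowFrameU L M β U μ n).eval (WithLp.ofLp q)) = evalM (klFlowFrameU L M β U μ n) := rfl
  rw [e]
  have hG := hR j
  interval_cases j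
  · have hg0 := hg 0 (by norm_num)
    rw [hUabs] at h0
    calc _ ≤ 16 / 15 * R.Gfr 0 * U := h0
      _ = 16 / 15 * (R.Gfr 0 * U) := by ring
      _ ≤ 16 / 15 * (1 / 2 ^ 127) := by gcongr
      _ ≤ 1 / 10 ^ 12 := by norm_num
  · have hg1 := hg 1 (by norm_num)
    calc _ ≤ 4 / 3 * R.Gfr 1 * U ^ 2 := h1
      _ ≤ 4 / 3 * R.Gfr 1 * U := by gcongr
      _ = 4 / 3 * (R.Gfr 1 * U) := by ring
      _ ≤ 4 / 3 * (1 / 2 ^ 127) := by gcongr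
      _ ≤ 1 / 10 ^ 12 := by norm_num
  · have hg2 := hg 2 (by norm_num)
    calc _ ≤ n * R.Gfr 2 * U ^ 2 := h2
      _ ≤ 21 * R.Gfr 2 * U := by
          have : (n : ℝ) * R.Gfr 2 * U ^ 2 ≤ 21 * R.Gfr 2 * U ^ 2 := by gcongr
          exact this.trans (by nlinarith [mul_nonneg (show (0:ℝ) ≤ 21 * R.Gfr 2 by positivity) (sub_nonneg.2 hU2)])
      _ = 21 * (R.Gfr 2 * U) := by ring
      _ ≤ 21 * (1 / 2 ^ 127) := by gcongr
      _ ≤ 1 / 10 ^ 12 := by norm_num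
  · have hg3 := hg 3 (by norm_num)
    calc _ ≤ R.Gfr 3 / 3 * U ^ 2 * 4 ^ n := h3
      _ ≤ R.Gfr 3 / 3 * U * 4 ^ 21 := by gcongr
      _ = 4 ^ 21 / 3 * (R.Gfr 3 * U) := by ring
      _ ≤ 4 ^ 21 / 3 * (1 / 2 ^ 127) := by gcongr
      _ ≤ 1 / 10 ^ 12 := by norm_num
  · have hg4 := hg 4 (by norm_num)
    calc _ ≤ R.Gfr 4 / 15 * U ^ 2 * 16 ^ n := h4
      _ ≤ R.Gfr 4 / 15 * U * 16 ^ 21 := by gcongr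
      _ = 16 ^ 21 / 15 * (R.Gfr 4 * U) := by ring
      _ ≤ 16 ^ 21 / 15 * (1 / 2 ^ 127) := by gcongr
      _ ≤ 1 / 10 ^ 12 := by norm_num

/-- The same below the stub's registered binder `U ≤ klEngU₀9 P R c` (`klEngU₀9 ≤ klEngU₀4`), `n ≤ 21`. -/
theorem flowFrame_sizes_le_of_klEngU₀9_of_le {P : SplitConsts} {R : RenConsts} (hRW : R.WF) {c β U μ : ℝ} (hU : 0 < U)
    (hUle : U ≤ klEngU₀9 P R c) {n : ℕ} (hn : n ≤ 21) (hist : ∀ m < n, FlowPieceJetsAt L M β U μ R m) :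
    ∀ j ≤ 4, ∀ p : EuclideanSpace ℝ (Fin 2),
      ‖iteratedFDeriv ℝ j (fun q : EuclideanSpace ℝ (Fin 2) => (klFlowFrameU L M β U μ n).eval (WithLp.ofLp q)) p‖ ≤ 1 / 10 ^ 12 :=
  flowFrame_sizes_le_of_klEngU₀4_of_le hRW hU (hUle.trans (klEngU₀9_le_klEngU₀4 P R c)) hn hist

/-- **`hA` for any table `A ≥ 10⁻¹²`** (`j ≤ 4`), flow frame `K_n`, `n ≤ 21`, below `klEngU₀9`. -/
theorem flowFrame_sizes_le_table_of_klEngU₀9_of_le {P : SplitConsts} {R : RenConsts} (hRW : R.WF) {c β U μ : ℝ} (hU : 0 < U)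
    (hUle : U ≤ klEngU₀9 P R c) {n : ℕ} (hn : n ≤ 21) (hist : ∀ m < n, FlowPieceJetsAt L M β U μ R m)
    {A : ℕ → ℝ} (hA12 : ∀ j ≤ 4, (1 : ℝ) / 10 ^ 12 ≤ A j) :
    ∀ j ≤ 4, ∀ p : EuclideanSpace ℝ (Fin 2),
      ‖iteratedFDeriv ℝ j (fun q : EuclideanSpace ℝ (Fin 2) => (klFlowFrameU L M β U μ n).eval (WithLp.ofLp q)) p‖ ≤ A j :=
  fun j hj p => (flowFrame_sizes_le_of_klEngU₀9_of_le hRW hU hUle hn hist j hj p).trans (hA12 j hj)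

end FrameSizes

/-! ## §2 The deep records' size tables -/

/-- `klC1FrameAF8192 ≡ 10⁻¹²` on `j ≤ 4`. -/
theorem klC1FrameAF8192_ge : ∀ j ≤ 4, (1 : ℝ) / 10 ^ 12 ≤ klC1FrameAF8192 j := by
  intro j hj; interval_cases j <;> norm_num [klC1FrameAF8192]

/-- `klC1FrameAF32768 ≡ 10⁻¹²` on `j ≤ 4`. -/
theorem klC1FrameAF32768_ge : ∀ j ≤ 4, (1 : ℝ) / 10 ^ 12 ≤ klC1FrameAF32768 j := by
  intro j hj; interval_cases j <;> norm_num [klC1FrameAF32768]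

/-- `klC1FrameAF128r ≡ 10⁻¹²` on `j ≤ 4`. -/
theorem klC1FrameAF128r_ge : ∀ j ≤ 4, (1 : ℝ) / 10 ^ 12 ≤ klC1FrameAF128r j := klC1FrameA_records_ge.2.2.1

/-- `klC1FrameAF512 ≡ 10⁻¹²` on `j ≤ 4`. -/
theorem klC1FrameAF512_ge : ∀ j ≤ 4, (1 : ℝ) / 10 ^ 12 ≤ klC1FrameAF512 j := klC1FrameA_records_ge.2.1

/-- `klC1FrameAF2048 ≡ 10⁻¹²` on `j ≤ 4`. -/
theorem klC1FrameAF2048_ge : ∀ j ≤ 4, (1 : ℝ) / 10 ^ 12 ≤ klC1FrameAF2048 j := klC1FrameA_records_ge.1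

/-- **All six records' size tables are `≡ 10⁻¹²` on `j ≤ 4`** (128r, 256, 512, 2048, 8192, 32768). -/
theorem klC1FrameA_records_ge₆ :
    (∀ j ≤ 4, (1 : ℝ) / 10 ^ 12 ≤ klC1FrameAF128r j) ∧ (∀ j ≤ 4, (1 : ℝ) / 10 ^ 12 ≤ klC1FrameAF256 j) ∧
    (∀ j ≤ 4, (1 : ℝ) / 10 ^ 12 ≤ klC1FrameAF512 j) ∧ (∀ j ≤ 4, (1 : ℝ) / 10 ^ 12 ≤ klC1FrameAF2048 j) ∧
    (∀ j ≤ 4, (1 : ℝ) / 10 ^ 12 ≤ klC1FrameAF8192 j) ∧ (∀ j ≤ 4, (1 : ℝ) / 10 ^ 12 ≤ klC1FrameAF32768 j) :=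
  ⟨klC1FrameAF128r_ge, klC1FrameA_records_ge.2.2.2, klC1FrameAF512_ge, klC1FrameAF2048_ge, klC1FrameAF8192_ge, klC1FrameAF32768_ge⟩

/-- The degree schedule at the five table scales: `klFlowDeg 0 … 4 = 128, 512, 2048, 8192, 32768`. -/
theorem klFlowDeg_table : klFlowDeg 0 = 128 ∧ klFlowDeg 1 = 512 ∧ klFlowDeg 2 = 2048 ∧ klFlowDeg 3 = 8192 ∧ klFlowDeg 4 = 32768 := by
  refine ⟨?_, ?_, ?_, ?_, ?_⟩ <;> norm_num [klFlowDeg]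

/-! ## §3 The one-call doors at the stub's binders, reading scales `n + 1 ≤ 21` -/

section Stub

variable {L M : ℕ} [NeZero L] [NeZero M]

/-- **THE (C1) DOOR AT STUB (C)'s BINDERS, ONE CALL, `n + 1 ≤ 21`** — `readResidueC1_jets_of_certFrame_klEng` (p586216) with the reading-scale
restriction lifted from `n + 1 ≤ 4` to `n + 1 ≤ 21`: from `R.WF`, `0 < c ≤ klEngC₃6 P R`, `μ ∈ klWindowC`, `0 < U ≤ klEngU₀9 P R c`,
`klBetaMin ≤ β ≤ e^{c/U²}`, `FrameOK R U (nScales β) μ K_{n+1}`, the history's `FlowPieceJetsAt … m` (`m ≤ n`), ANY certificate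
`CutoffDefectCertFrame (klFlowDeg n) A T` at a table `A ≥ 10⁻¹²` (all six records), and the `C⁴` induction hypothesis in natural-size form. -/
theorem readResidueC1_jets_of_certFrame_klEng_of_le {P : SplitConsts} {R : RenConsts} (hRW : R.WF) {c : ℝ} (hc : 0 < c)
    (hc6 : c ≤ klEngC₃6 P R) {μ : ℝ} (hμ : μ ∈ klWindowC) {U : ℝ} (hU : 0 < U) (hU9 : U ≤ klEngU₀9 P R c) {β : ℝ}
    (hβmin : klBetaMin ≤ β) (hβc : β ≤ Real.exp (c / U ^ 2)) {n : ℕ} (hn : n + 1 ≤ 21)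
    (hK : FrameOK R U (nScales β) μ (klFlowFrameU L M β U μ (n + 1))) (hist : ∀ m < n + 1, FlowPieceJetsAt L M β U μ R m)
    {d : ℕ} (hd : klFlowDeg n = d) {A : ℕ → ℝ} {T : CutoffDefectTable} (hcert : CutoffDefectCertFrame d A T)
    (hA12 : ∀ j ≤ 4, (1 : ℝ) / 10 ^ 12 ≤ A j)
    (hf : ContDiff ℝ 4 fun θ : ℝ => klLocalPart L M β U μ (klFlowFrameU L M β U μ n) n θ)
    {a : ℕ → ℝ} (ha_nn : ∀ l, 0 ≤ a l)
    (ha0 : ∀ x, |klLocalPart L M β U μ (klFlowFrameU L M β U μ n) n x -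
      klAngularMean (fun θ => klLocalPart L M β U μ (klFlowFrameU L M β U μ n) n θ)| ≤ a 0)
    (ha : ∀ l, 1 ≤ l → l ≤ 4 → ∀ x, |iteratedDeriv l (fun x => klLocalPart L M β U μ (klFlowFrameU L M β U μ n) n x) x| ≤ a l) :
    ContDiff ℝ 4 (fun θ : ℝ => klLocalPart L M β U μ (klFlowFrameU L M β U μ n) n θ -
        (klFlowPiece L M β U μ n).eval (klFermiPoint μ (klFlowFrameU L M β U μ (n + 1)) θ)) ∧
    (∀ θ : ℝ, |klLocalPart L M β U μ (klFlowFrameU L M β U μ n) n θ -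
        (klFlowPiece L M β U μ n).eval (klFermiPoint μ (klFlowFrameU L M β U μ (n + 1)) θ)| ≤ a 1 * T.Td + a 0 * T.N0) ∧
    (∀ k, 1 ≤ k → k ≤ 3 → ∀ θ : ℝ, |iteratedDeriv k (fun θ : ℝ => klLocalPart L M β U μ (klFlowFrameU L M β U μ n) n θ -
        (klFlowPiece L M β U μ n).eval (klFermiPoint μ (klFlowFrameU L M β U μ (n + 1)) θ)) θ| ≤ T.bound a k) ∧
    (∀ k, 1 ≤ k → k ≤ 4 → ∀ θ : ℝ, |iteratedDeriv k (fun θ : ℝ => klLocalPart L M β U μ (klFlowFrameU L M β U μ n) n θ -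
        (klFlowPiece L M β U μ n).eval (klFermiPoint μ (klFlowFrameU L M β U μ (n + 1)) θ)) θ| ≤ T.boundNR a k) := by
  have hR : ∀ j, 0 ≤ R.Gfr j := hRW.2.2
  have hcle : c ≤ klCurveC3 R := hc6.trans ((klEngC₃6_le_klEngC₃3 P R).trans (klEngC₃3_le_klCurveC3 P hR))
  have hUle : U ≤ klCurveU0 R := hU9.trans ((klEngU₀9_le_klEngU₀3 P R c).trans (klEngU₀3_le_klCurveU0 P hR c))
  have hA := flowFrame_sizes_le_table_of_klEngU₀9_of_le (L := L) (M := M) (β := β) (μ := μ) hRW hU hU9 hn hist hA12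
  exact readResidueC1_jets_of_certFrame hR hc hcle hU hUle hβmin hβc hμ hK hd hcert hA hf ha_nn ha0 ha

/-- **THE (C1) DOOR KEYED BY THE INDUCTION HYPOTHESIS, AT STUB (C)'s BINDERS, `n + 1 ≤ 21`** — `readResidueC1_jets_of_twoLegReadJetBound_klEng`
(p586985) with the reading-scale restriction lifted: sizes `a l := curveJetBar cc cc' U l n` (`l ≥ 1`), `a 0 := (π/2)·curveJetBar cc cc' U 1 n`
(mean-free sup from the slope). -/
theorem readResidueC1_jets_of_twoLegReadJetBound_klEng_of_le {P : SplitConsts} {R : RenConsts} (hRW : R.WF) {c : ℝ} (hc : 0 < c)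
    (hc6 : c ≤ klEngC₃6 P R) {μ : ℝ} (hμ : μ ∈ klWindowC) {U : ℝ} (hU : 0 < U) (hU9 : U ≤ klEngU₀9 P R c) {β : ℝ}
    (hβmin : klBetaMin ≤ β) (hβc : β ≤ Real.exp (c / U ^ 2)) {n : ℕ} (hn : n + 1 ≤ 21)
    (hK : FrameOK R U (nScales β) μ (klFlowFrameU L M β U μ (n + 1))) (hist : ∀ m < n + 1, FlowPieceJetsAt L M β U μ R m)
    {d : ℕ} (hd : klFlowDeg n = d) {A : ℕ → ℝ} {T : CutoffDefectTable} (hcert : CutoffDefectCertFrame d A T)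
    (hA12 : ∀ j ≤ 4, (1 : ℝ) / 10 ^ 12 ≤ A j)
    {cc cc' : ℕ → ℝ} (hcc : ∀ k, 0 ≤ cc k) (hcc' : ∀ k, 0 ≤ cc' k)
    (hIH : TwoLegReadJetBound L M cc cc' β U μ (klFlowFrameU L M β U μ n) n) :
    ContDiff ℝ 4 (fun θ : ℝ => klLocalPart L M β U μ (klFlowFrameU L M β U μ n) n θ -
        (klFlowPiece L M β U μ n).eval (klFermiPoint μ (klFlowFrameU L M β U μ (n + 1)) θ)) ∧
    (∀ θ : ℝ, |klLocalPart L M β U μ (klFlowFrameU L M β U μ n) n θ -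
        (klFlowPiece L M β U μ n).eval (klFermiPoint μ (klFlowFrameU L M β U μ (n + 1)) θ)| ≤
      curveJetBar cc cc' U 1 n * T.Td + π / 2 * curveJetBar cc cc' U 1 n * T.N0) ∧
    (∀ k, 1 ≤ k → k ≤ 3 → ∀ θ : ℝ, |iteratedDeriv k (fun θ : ℝ => klLocalPart L M β U μ (klFlowFrameU L M β U μ n) n θ -
        (klFlowPiece L M β U μ n).eval (klFermiPoint μ (klFlowFrameU L M β U μ (n + 1)) θ)) θ| ≤
      T.bound (fun l : ℕ => if l = 0 then π / 2 * curveJetBar cc cc' U 1 n else curveJetBar cc cc' U l n) k) ∧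
    (∀ k, 1 ≤ k → k ≤ 4 → ∀ θ : ℝ, |iteratedDeriv k (fun θ : ℝ => klLocalPart L M β U μ (klFlowFrameU L M β U μ n) n θ -
        (klFlowPiece L M β U μ n).eval (klFermiPoint μ (klFlowFrameU L M β U μ (n + 1)) θ)) θ| ≤
      T.boundNR (fun l : ℕ => if l = 0 then π / 2 * curveJetBar cc cc' U 1 n else curveJetBar cc cc' U l n) k) := by
  have hR : ∀ j, 0 ≤ R.Gfr j := hRW.2.2
  have hcle : c ≤ klCurveC3 R := hc6.trans ((klEngC₃6_le_klEngC₃3 P R).trans (klEngC₃3_le_klCurveC3 P hR))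
  have hUle : U ≤ klCurveU0 R := hU9.trans ((klEngU₀9_le_klEngU₀3 P R c).trans (klEngU₀3_le_klCurveU0 P hR c))
  have hA := flowFrame_sizes_le_table_of_klEngU₀9_of_le (L := L) (M := M) (β := β) (μ := μ) hRW hU hU9 hn hist hA12
  exact readResidueC1_jets_of_twoLegReadJetBound hR hc hcle hU hUle hβmin hβc hμ hK hd hcert hA hcc hcc' hIH

end Stub

/-! ## §4 The five fully instantiated table calls (IH-keyed form) -/

section Tables

variable {L M : ℕ} [NeZero L] [NeZero M]
  {P : SplitConsts} {R : RenConsts} (hRW : R.WF) {c : ℝ} (hc : 0 < c) (hc6 : c ≤ klEngC₃6 P R) {μ : ℝ} (hμ : μ ∈ klWindowC)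
  {U : ℝ} (hU : 0 < U) (hU9 : U ≤ klEngU₀9 P R c) {β : ℝ} (hβmin : klBetaMin ≤ β) (hβc : β ≤ Real.exp (c / U ^ 2))
  {cc cc' : ℕ → ℝ} (hcc : ∀ k, 0 ≤ cc k) (hcc' : ∀ k, 0 ≤ cc' k)
include hRW hc hc6 hμ hU hU9 hβmin hβc hcc hcc'

/-- **Reading scale `n + 1 = 1`** (`n = 0`, `d = 128`, record `klC1FrameAF128r / klC1TableF128r`). -/
theorem readResidueC1_jets_table128r (hcert : CutoffDefectCertFrame 128 klC1FrameAF128r klC1TableF128r)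
    (hK : FrameOK R U (nScales β) μ (klFlowFrameU L M β U μ (0 + 1))) (hist : ∀ m < 0 + 1, FlowPieceJetsAt L M β U μ R m)
    (hIH : TwoLegReadJetBound L M cc cc' β U μ (klFlowFrameU L M β U μ 0) 0) :
    ContDiff ℝ 4 (fun θ : ℝ => klLocalPart L M β U μ (klFlowFrameU L M β U μ 0) 0 θ -
        (klFlowPiece L M β U μ 0).eval (klFermiPoint μ (klFlowFrameU L M β U μ (0 + 1)) θ)) ∧
    (∀ θ : ℝ, |klLocalPart L M β U μ (klFlowFrameU L M β U μ 0) 0 θ -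
        (klFlowPiece L M β U μ 0).eval (klFermiPoint μ (klFlowFrameU L M β U μ (0 + 1)) θ)| ≤
      curveJetBar cc cc' U 1 0 * klC1TableF128r.Td + π / 2 * curveJetBar cc cc' U 1 0 * klC1TableF128r.N0) ∧
    (∀ k, 1 ≤ k → k ≤ 3 → ∀ θ : ℝ, |iteratedDeriv k (fun θ : ℝ => klLocalPart L M β U μ (klFlowFrameU L M β U μ 0) 0 θ -
        (klFlowPiece L M β U μ 0).eval (klFermiPoint μ (klFlowFrameU L M β U μ (0 + 1)) θ)) θ| ≤
      klC1TableF128r.bound (fun l : ℕ => if l = 0 then π / 2 * curveJetBar cc cc' U 1 0 else curveJetBar cc cc' U l 0) k) ∧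
    (∀ k, 1 ≤ k → k ≤ 4 → ∀ θ : ℝ, |iteratedDeriv k (fun θ : ℝ => klLocalPart L M β U μ (klFlowFrameU L M β U μ 0) 0 θ -
        (klFlowPiece L M β U μ 0).eval (klFermiPoint μ (klFlowFrameU L M β U μ (0 + 1)) θ)) θ| ≤
      klC1TableF128r.boundNR (fun l : ℕ => if l = 0 then π / 2 * curveJetBar cc cc' U 1 0 else curveJetBar cc cc' U l 0) k) :=
  readResidueC1_jets_of_twoLegReadJetBound_klEng_of_le hRW hc hc6 hμ hU hU9 hβmin hβc (by norm_num) hK hist klFlowDeg_table.1 hcert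
    klC1FrameAF128r_ge hcc hcc' hIH

/-- **Reading scale `n + 1 = 2`** (`n = 1`, `d = 512`, record `klC1FrameAF512 / klC1TableF512`). -/
theorem readResidueC1_jets_table512 (hcert : CutoffDefectCertFrame 512 klC1FrameAF512 klC1TableF512)
    (hK : FrameOK R U (nScales β) μ (klFlowFrameU L M β U μ (1 + 1))) (hist : ∀ m < 1 + 1, FlowPieceJetsAt L M β U μ R m)
    (hIH : TwoLegReadJetBound L M cc cc' β U μ (klFlowFrameU L M β U μ 1) 1) :
    ContDiff ℝ 4 (fun θ : ℝ => klLocalPart L M β U μ (klFlowFrameU L M β U μ 1) 1 θ -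
        (klFlowPiece L M β U μ 1).eval (klFermiPoint μ (klFlowFrameU L M β U μ (1 + 1)) θ)) ∧
    (∀ θ : ℝ, |klLocalPart L M β U μ (klFlowFrameU L M β U μ 1) 1 θ -
        (klFlowPiece L M β U μ 1).eval (klFermiPoint μ (klFlowFrameU L M β U μ (1 + 1)) θ)| ≤
      curveJetBar cc cc' U 1 1 * klC1TableF512.Td + π / 2 * curveJetBar cc cc' U 1 1 * klC1TableF512.N0) ∧
    (∀ k, 1 ≤ k → k ≤ 3 → ∀ θ : ℝ, |iteratedDeriv k (fun θ : ℝ => klLocalPart L M β U μ (klFlowFrameU L M β U μ 1) 1 θ -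
        (klFlowPiece L M β U μ 1).eval (klFermiPoint μ (klFlowFrameU L M β U μ (1 + 1)) θ)) θ| ≤
      klC1TableF512.bound (fun l : ℕ => if l = 0 then π / 2 * curveJetBar cc cc' U 1 1 else curveJetBar cc cc' U l 1) k) ∧
    (∀ k, 1 ≤ k → k ≤ 4 → ∀ θ : ℝ, |iteratedDeriv k (fun θ : ℝ => klLocalPart L M β U μ (klFlowFrameU L M β U μ 1) 1 θ -
        (klFlowPiece L M β U μ 1).eval (klFermiPoint μ (klFlowFrameU L M β U μ (1 + 1)) θ)) θ| ≤
      klC1TableF512.boundNR (fun l : ℕ => if l = 0 then π / 2 * curveJetBar cc cc' U 1 1 else curveJetBar cc cc' U l 1) k) :=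
  readResidueC1_jets_of_twoLegReadJetBound_klEng_of_le hRW hc hc6 hμ hU hU9 hβmin hβc (by norm_num) hK hist klFlowDeg_table.2.1 hcert
    klC1FrameAF512_ge hcc hcc' hIH

/-- **Reading scale `n + 1 = 3`** (`n = 2`, `d = 2048`, record `klC1FrameAF2048 / klC1TableF2048`). -/
theorem readResidueC1_jets_table2048 (hcert : CutoffDefectCertFrame 2048 klC1FrameAF2048 klC1TableF2048)
    (hK : FrameOK R U (nScales β) μ (klFlowFrameU L M β U μ (2 + 1))) (hist : ∀ m < 2 + 1, FlowPieceJetsAt L M β U μ R m)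
    (hIH : TwoLegReadJetBound L M cc cc' β U μ (klFlowFrameU L M β U μ 2) 2) :
    ContDiff ℝ 4 (fun θ : ℝ => klLocalPart L M β U μ (klFlowFrameU L M β U μ 2) 2 θ -
        (klFlowPiece L M β U μ 2).eval (klFermiPoint μ (klFlowFrameU L M β U μ (2 + 1)) θ)) ∧
    (∀ θ : ℝ, |klLocalPart L M β U μ (klFlowFrameU L M β U μ 2) 2 θ -
        (klFlowPiece L M β U μ 2).eval (klFermiPoint μ (klFlowFrameU L M β U μ (2 + 1)) θ)| ≤
      curveJetBar cc cc' U 1 2 * klC1TableF2048.Td + π / 2 * curveJetBar cc cc' U 1 2 * klC1TableF2048.N0) ∧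
    (∀ k, 1 ≤ k → k ≤ 3 → ∀ θ : ℝ, |iteratedDeriv k (fun θ : ℝ => klLocalPart L M β U μ (klFlowFrameU L M β U μ 2) 2 θ -
        (klFlowPiece L M β U μ 2).eval (klFermiPoint μ (klFlowFrameU L M β U μ (2 + 1)) θ)) θ| ≤
      klC1TableF2048.bound (fun l : ℕ => if l = 0 then π / 2 * curveJetBar cc cc' U 1 2 else curveJetBar cc cc' U l 2) k) ∧
    (∀ k, 1 ≤ k → k ≤ 4 → ∀ θ : ℝ, |iteratedDeriv k (fun θ : ℝ => klLocalPart L M β U μ (klFlowFrameU L M β U μ 2) 2 θ -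
        (klFlowPiece L M β U μ 2).eval (klFermiPoint μ (klFlowFrameU L M β U μ (2 + 1)) θ)) θ| ≤
      klC1TableF2048.boundNR (fun l : ℕ => if l = 0 then π / 2 * curveJetBar cc cc' U 1 2 else curveJetBar cc cc' U l 2) k) :=
  readResidueC1_jets_of_twoLegReadJetBound_klEng_of_le hRW hc hc6 hμ hU hU9 hβmin hβc (by norm_num) hK hist klFlowDeg_table.2.2.1 hcert
    klC1FrameAF2048_ge hcc hcc' hIH

/-- **Reading scale `n + 1 = 4`** (`n = 3`, `d = 8192`, record `klC1FrameAF8192 / klC1TableF8192`, k3c3-p3 g11). -/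
theorem readResidueC1_jets_table8192 (hcert : CutoffDefectCertFrame 8192 klC1FrameAF8192 klC1TableF8192)
    (hK : FrameOK R U (nScales β) μ (klFlowFrameU L M β U μ (3 + 1))) (hist : ∀ m < 3 + 1, FlowPieceJetsAt L M β U μ R m)
    (hIH : TwoLegReadJetBound L M cc cc' β U μ (klFlowFrameU L M β U μ 3) 3) :
    ContDiff ℝ 4 (fun θ : ℝ => klLocalPart L M β U μ (klFlowFrameU L M β U μ 3) 3 θ -
        (klFlowPiece L M β U μ 3).eval (klFermiPoint μ (klFlowFrameU L M β U μ (3 + 1)) θ)) ∧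
    (∀ θ : ℝ, |klLocalPart L M β U μ (klFlowFrameU L M β U μ 3) 3 θ -
        (klFlowPiece L M β U μ 3).eval (klFermiPoint μ (klFlowFrameU L M β U μ (3 + 1)) θ)| ≤
      curveJetBar cc cc' U 1 3 * klC1TableF8192.Td + π / 2 * curveJetBar cc cc' U 1 3 * klC1TableF8192.N0) ∧
    (∀ k, 1 ≤ k → k ≤ 3 → ∀ θ : ℝ, |iteratedDeriv k (fun θ : ℝ => klLocalPart L M β U μ (klFlowFrameU L M β U μ 3) 3 θ -
        (klFlowPiece L M β U μ 3).eval (klFermiPoint μ (klFlowFrameU L M β U μ (3 + 1)) θ)) θ| ≤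
      klC1TableF8192.bound (fun l : ℕ => if l = 0 then π / 2 * curveJetBar cc cc' U 1 3 else curveJetBar cc cc' U l 3) k) ∧
    (∀ k, 1 ≤ k → k ≤ 4 → ∀ θ : ℝ, |iteratedDeriv k (fun θ : ℝ => klLocalPart L M β U μ (klFlowFrameU L M β U μ 3) 3 θ -
        (klFlowPiece L M β U μ 3).eval (klFermiPoint μ (klFlowFrameU L M β U μ (3 + 1)) θ)) θ| ≤
      klC1TableF8192.boundNR (fun l : ℕ => if l = 0 then π / 2 * curveJetBar cc cc' U 1 3 else curveJetBar cc cc' U l 3) k) :=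
  readResidueC1_jets_of_twoLegReadJetBound_klEng_of_le hRW hc hc6 hμ hU hU9 hβmin hβc (by norm_num) hK hist klFlowDeg_table.2.2.2.1 hcert
    klC1FrameAF8192_ge hcc hcc' hIH

/-- **Reading scale `n + 1 = 5`** (`n = 4`, `d = 32768`, record `klC1FrameAF32768 / klC1TableF32768`, k3c3-p3 g11). -/
theorem readResidueC1_jets_table32768 (hcert : CutoffDefectCertFrame 32768 klC1FrameAF32768 klC1TableF32768)
    (hK : FrameOK R U (nScales β) μ (klFlowFrameU L M β U μ (4 + 1))) (hist : ∀ m < 4 + 1, FlowPieceJetsAt L M β U μ R m)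
    (hIH : TwoLegReadJetBound L M cc cc' β U μ (klFlowFrameU L M β U μ 4) 4) :
    ContDiff ℝ 4 (fun θ : ℝ => klLocalPart L M β U μ (klFlowFrameU L M β U μ 4) 4 θ -
        (klFlowPiece L M β U μ 4).eval (klFermiPoint μ (klFlowFrameU L M β U μ (4 + 1)) θ)) ∧
    (∀ θ : ℝ, |klLocalPart L M β U μ (klFlowFrameU L M β U μ 4) 4 θ -
        (klFlowPiece L M β U μ 4).eval (klFermiPoint μ (klFlowFrameU L M β U μ (4 + 1)) θ)| ≤
      curveJetBar cc cc' U 1 4 * klC1TableF32768.Td + π / 2 * curveJetBar cc cc' U 1 4 * klC1TableF32768.N0) ∧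
    (∀ k, 1 ≤ k → k ≤ 3 → ∀ θ : ℝ, |iteratedDeriv k (fun θ : ℝ => klLocalPart L M β U μ (klFlowFrameU L M β U μ 4) 4 θ -
        (klFlowPiece L M β U μ 4).eval (klFermiPoint μ (klFlowFrameU L M β U μ (4 + 1)) θ)) θ| ≤
      klC1TableF32768.bound (fun l : ℕ => if l = 0 then π / 2 * curveJetBar cc cc' U 1 4 else curveJetBar cc cc' U l 4) k) ∧
    (∀ k, 1 ≤ k → k ≤ 4 → ∀ θ : ℝ, |iteratedDeriv k (fun θ : ℝ => klLocalPart L M β U μ (klFlowFrameU L M β U μ 4) 4 θ -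
        (klFlowPiece L M β U μ 4).eval (klFermiPoint μ (klFlowFrameU L M β U μ (4 + 1)) θ)) θ| ≤
      klC1TableF32768.boundNR (fun l : ℕ => if l = 0 then π / 2 * curveJetBar cc cc' U 1 4 else curveJetBar cc cc' U l 4) k) :=
  readResidueC1_jets_of_twoLegReadJetBound_klEng_of_le hRW hc hc6 hμ hU hU9 hβmin hβc (by norm_num) hK hist klFlowDeg_table.2.2.2.2
    hcert klC1FrameAF32768_ge hcc hcc' hIH

end Tables

end Summit.HubbardSuperconductivity.HubbardSuperconductivity.Theorems.KLRegimeSplit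

end
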